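import Summits.QuantumFields.YangMills.Theorems.ScalingWindowSplitSelfNormalisedSkewnessWitnessFrame
import Summits.QuantumFields.YangMills.Theorems.ScalingWindowSplitSelfNormalisedSkewnessStubWickSquaresSums
import Summits.QuantumFields.YangMills.Theorems.ScalingWindowSplitSelfNormalisedSkewnessStubParsevalGaussianMoments
import Summits.QuantumFields.YangMills.Theorems.ScalingWindowSplitSelfNormalisedSkewnessStubGaussianBoxComparison
import Summits.QuantumFields.YangMills.Theorems.ScalingWindowSplitSelfNormalisedSkewnessStubBoxTaylorCumulants
import HarnessLib

/-!
# `SelfNormalisedSkewness` — negative side: per-site cumulants on the small box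

Route `ScalingWindowSplit`, crux `stmt-QuantumFields-18944`, line `Sketch` (negation branch), support for the
lead's `stub_witnessAssembly`.  On `V = im d ⊆ ℝ^{Plaquette 4 S}` with the box probability `boxProb S β ε` of
`WitnessBoxMeasure` and the frame / per-site observables of `WitnessFrame` we prove the per-site cumulant formulas ON THE BOX
(Taylor step `stub_boxTaylorCumulants`, Gaussian comparison `stub_gaussianBoxComparison`, Wick calculus
`stub_wickSquaresSums`):
`κ₃^{box}(cosSite x, cosSite y, cosSite z) = −β⁻³ · ring_{πK}(x,y,z) + O(ε⁸ + β⁻³ ξ)` and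
`Cov^{box}(cosSite x, cosSite y) = (2β²)⁻¹ Σ πK² + O(ε⁶ + β⁻² ξ)`, `ξ = β·#P·ε⁴ + #P·(ε√β)⁻⁶`.

References: Lüscher 1999 §3; standard Gaussian calculus.  No definitions of propositions, no named facts.
-/

noncomputable section

open scoped BigOperators ENNReal InnerProductSpace
open MeasureTheory ProbabilityTheory
open Literature.MathematicalPhysics.QuantumLattice Literature.MathematicalPhysics.QuantumFieldTheory
open Literature.Probability.LatticeModels (TorusSite torusGreen)
open Summit.QuantumFields.YangMills.Theorems.CurvatureBoostCovariance.Negative (card_planes)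

namespace Summit.QuantumFields.YangMills.Theorems.SelfNormalisedSkewness.Negative
variable {S : ℕ} [NeZero S]

/-! ### Step B: Taylor reduction on the box -/

/-- **Taylor step on the box**: `κ₃^{box}(cosSite) = −⅛ κ₃^{box}(sqSite) + O(ε⁸)` and
`Cov^{box}(cosSite) = ¼ Cov^{box}(sqSite) + O(ε⁶)`. [folklore] -/
theorem box_taylor {β ε : ℝ} (hβ : 0 ≤ β) (hε0 : 0 < ε) (hε1 : ε ≤ 1) (x y z : Site 4 S) :
    |cm3 (boxProb S β ε) (cosSite x) (cosSite y) (cosSite z) +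
        (1 / 8 : ℝ) * cm3 (boxProb S β ε) (sqSite x) (sqSite y) (sqSite z)| ≤ 10 * ε ^ 8 ∧
    |cm2 (boxProb S β ε) (cosSite x) (cosSite y) -
        (1 / 4 : ℝ) * cm2 (boxProb S β ε) (sqSite x) (sqSite y)| ≤ 10 * ε ^ 6 := by
  haveI := isProbabilityMeasure_boxProb (S := S) hβ hε0
  have h := stub_boxTaylorCumulants (boxProb S β ε) (fun p w => ⟪frameV S p, w⟫_ℝ) measurable_inner_frameV
    hε0 hε1 (ae_abs_inner_frameV_lt β ε) (sitePlaqs x) (sitePlaqs y) (sitePlaqs z) (card_sitePlaqs_le x)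
    (card_sitePlaqs_le y) (card_sitePlaqs_le z)
  simp only [sum_sitePlaqs] at h
  exact h

/-! ### Step C: the raw box moments of `sqSite` against the standard Gaussian of `V` -/

example : (volume : Measure (LinearMap.range (plaqCoboundary S))) =
    @volume _ (measureSpaceOfInnerProductSpace) := rfl

/-- **Gaussian comparison of the raw box moments** (instantiating `stub_gaussianBoxComparison` on `V`).
[folklore] -/
theorem box_raw_vs_gaussian : ∃ C : ℝ, 0 < C ∧ ∀ (S : ℕ) [NeZero S] (β ε : ℝ), 0 < β → 0 < ε →
    1 ≤ ε * Real.sqrt β → β * Fintype.card (Plaquette 4 S) * ε ^ 4 ≤ 1 →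
    (stdGaussian (LinearMap.range (plaqCoboundary S))).real
        {w | ∃ p, ε * Real.sqrt β ≤ |⟪frameV S p, w⟫_ℝ|} ≤ 1 / 2 →
    ∀ (A B D : Finset (Plaquette 4 S)), A.card ≤ 6 → B.card ≤ 6 → D.card ≤ 6 →
    |(∫ v, (∑ p ∈ A, ⟪frameV S p, v⟫_ℝ ^ 2) ∂(boxProb S β ε)) -
        β⁻¹ * ∫ w, (∑ p ∈ A, ⟪frameV S p, w⟫_ℝ ^ 2) ∂(stdGaussian (LinearMap.range (plaqCoboundary S)))| ≤
      C * β⁻¹ * (β * Fintype.card (Plaquette 4 S) * ε ^ 4 + Fintype.card (Plaquette 4 S) * (ε * Real.sqrt β)⁻¹ ^ 6) ∧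
    |(∫ v, (∑ p ∈ A, ⟪frameV S p, v⟫_ℝ ^ 2) * (∑ p ∈ B, ⟪frameV S p, v⟫_ℝ ^ 2) ∂(boxProb S β ε)) -
        β⁻¹ ^ 2 * ∫ w, (∑ p ∈ A, ⟪frameV S p, w⟫_ℝ ^ 2) * (∑ p ∈ B, ⟪frameV S p, w⟫_ℝ ^ 2)
          ∂(stdGaussian (LinearMap.range (plaqCoboundary S)))| ≤
      C * β⁻¹ ^ 2 * (β * Fintype.card (Plaquette 4 S) * ε ^ 4 + Fintype.card (Plaquette 4 S) * (ε * Real.sqrt β)⁻¹ ^ 6) ∧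
    |(∫ v, (∑ p ∈ A, ⟪frameV S p, v⟫_ℝ ^ 2) * (∑ p ∈ B, ⟪frameV S p, v⟫_ℝ ^ 2) * (∑ p ∈ D, ⟪frameV S p, v⟫_ℝ ^ 2)
          ∂(boxProb S β ε)) -
        β⁻¹ ^ 3 * ∫ w, (∑ p ∈ A, ⟪frameV S p, w⟫_ℝ ^ 2) * (∑ p ∈ B, ⟪frameV S p, w⟫_ℝ ^ 2) *
          (∑ p ∈ D, ⟪frameV S p, w⟫_ℝ ^ 2) ∂(stdGaussian (LinearMap.range (plaqCoboundary S)))| ≤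
      C * β⁻¹ ^ 3 * (β * Fintype.card (Plaquette 4 S) * ε ^ 4 + Fintype.card (Plaquette 4 S) * (ε * Real.sqrt β)⁻¹ ^ 6) := by
  obtain ⟨C, hC0, hC⟩ := stub_gaussianBoxComparison
  refine ⟨C, hC0, fun S _ β ε hβ hε ht hw htail A B D hA hB hD => ?_⟩
  have h := hC (frameV S) sum_sq_inner_frameV β ε hβ hε ht hw htail (boxN S β ε) (fun _ => rfl) A B D hA hB hD
  have m1 : ∀ A : Finset (Plaquette 4 S),
      Measurable fun v : LinearMap.range (plaqCoboundary S) => ∑ p ∈ A, ⟪frameV S p, v⟫_ℝ ^ 2 :=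
    fun A => Finset.measurable_sum _ fun p _ => (measurable_inner_frameV p).pow_const 2
  have n1 : ∀ (A : Finset (Plaquette 4 S)) (v : LinearMap.range (plaqCoboundary S)),
      0 ≤ ∑ p ∈ A, ⟪frameV S p, v⟫_ℝ ^ 2 := fun A v => Finset.sum_nonneg fun _ _ => sq_nonneg _
  have e1 := integral_boxProb_eq_div (β := β) (ε := ε) (m1 A) (n1 A)
  have e2 := integral_boxProb_eq_div (β := β) (ε := ε) ((m1 A).mul (m1 B)) (fun v => mul_nonneg (n1 A v) (n1 B v))
  have e3 := integral_boxProb_eq_div (β := β) (ε := ε) (((m1 A).mul (m1 B)).mul (m1 D))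
    (fun v => mul_nonneg (mul_nonneg (n1 A v) (n1 B v)) (n1 D v))
  simp only [Pi.mul_apply] at e2 e3
  rw [e1, e2, e3]
  exact h


/-! ### Integrability and sizes of `sqSite` on the box and under the Gaussian -/

/-- On the box, all six coordinates at a site are a.s. `< ε` in size. [folklore] -/
theorem ae_forall_abs_inner_lt (β ε : ℝ) (x : Site 4 S) :
    ∀ᵐ v ∂(boxProb S β ε), ∀ q : {q : Fin 4 × Fin 4 // q.1 < q.2}, |⟪frameV S (x, q), v⟫_ℝ| < ε :=
  ae_all_iff.2 fun q => ae_abs_inner_frameV_lt β ε (x, q)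

/-- On the box, `0 ≤ sqSite x ≤ 6 ε²` a.s. [folklore] -/
theorem ae_sqSite_le (β ε : ℝ) (x : Site 4 S) : ∀ᵐ v ∂(boxProb S β ε), sqSite x v ≤ 6 * ε ^ 2 := by
  filter_upwards [ae_forall_abs_inner_lt β ε x] with v hv
  unfold sqSite
  calc ∑ q : {q : Fin 4 × Fin 4 // q.1 < q.2}, ⟪frameV S (x, q), v⟫_ℝ ^ 2
      ≤ ∑ _q : {q : Fin 4 × Fin 4 // q.1 < q.2}, ε ^ 2 := Finset.sum_le_sum fun q _ => by
          have h := hv q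
          rw [← sq_abs]
          exact pow_le_pow_left₀ (abs_nonneg _) h.le 2
    _ = 6 * ε ^ 2 := by simp [card_planes]

/-- On the box, `|sqSite x| ≤ 6ε²` a.s. (norm form). [folklore] -/
theorem ae_norm_sqSite_le (β ε : ℝ) (x : Site 4 S) : ∀ᵐ v ∂(boxProb S β ε), ‖sqSite x v‖ ≤ 6 * ε ^ 2 := by
  filter_upwards [ae_sqSite_le β ε x] with v hv
  rw [Real.norm_eq_abs, abs_of_nonneg (sqSite_nonneg x v)]
  exact hv

/-- Box integrability of `sqSite` and its products. [folklore] -/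
theorem integrable_sqSite_box {β ε : ℝ} (hβ : 0 ≤ β) (hε : 0 < ε) (x y z : Site 4 S) :
    Integrable (sqSite x) (boxProb S β ε) ∧
    Integrable (fun v => sqSite x v * sqSite y v) (boxProb S β ε) ∧
    Integrable (fun v => sqSite x v * sqSite y v * sqSite z v) (boxProb S β ε) := by
  haveI := isProbabilityMeasure_boxProb (S := S) hβ hε
  have hm := fun x => (measurable_sqSite (S := S) x).aestronglyMeasurable (μ := boxProb S β ε)
  refine ⟨Integrable.of_bound (hm x) _ (ae_norm_sqSite_le β ε x),
    Integrable.of_bound ((hm x).mul (hm y)) ((6 * ε ^ 2) * (6 * ε ^ 2)) ?_,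
    Integrable.of_bound (((hm x).mul (hm y)).mul (hm z)) ((6 * ε ^ 2) * (6 * ε ^ 2) * (6 * ε ^ 2)) ?_⟩
  · filter_upwards [ae_norm_sqSite_le β ε x, ae_norm_sqSite_le β ε y] with v hx hy
    rw [norm_mul]
    exact mul_le_mul hx hy (norm_nonneg _) (by positivity)
  · filter_upwards [ae_norm_sqSite_le β ε x, ae_norm_sqSite_le β ε y, ae_norm_sqSite_le β ε z] with v hx hy hz
    rw [norm_mul, norm_mul]
    exact mul_le_mul (mul_le_mul hx hy (norm_nonneg _) (by positivity)) hz (norm_nonneg _) (by positivity)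

/-- Gaussian integrability and sizes of `sqSite` and its products (from `stub_parsevalGaussianMoments`).
[folklore] -/
theorem integrable_sqSite_gauss : ∃ C₂ : ℝ, 6 ≤ C₂ ∧ ∀ (S : ℕ) [NeZero S] (x y z : Site 4 S),
    Integrable (sqSite x) (stdGaussian (LinearMap.range (plaqCoboundary S))) ∧
    Integrable (fun w => sqSite x w * sqSite y w) (stdGaussian (LinearMap.range (plaqCoboundary S))) ∧
    Integrable (fun w => sqSite x w * sqSite y w * sqSite z w) (stdGaussian (LinearMap.range (plaqCoboundary S))) ∧
    |∫ w, sqSite x w ∂(stdGaussian (LinearMap.range (plaqCoboundary S)))| ≤ C₂ ∧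
    |∫ w, sqSite x w * sqSite y w ∂(stdGaussian (LinearMap.range (plaqCoboundary S)))| ≤ C₂ ∧
    |∫ w, sqSite x w * sqSite y w * sqSite z w ∂(stdGaussian (LinearMap.range (plaqCoboundary S)))| ≤ C₂ := by
  obtain ⟨C, hC0, hC⟩ := stub_parsevalGaussianMoments
  refine ⟨max C 6, le_max_right _ _, fun S _ x y z => ?_⟩
  have h := hC (frameV S) sum_sq_inner_frameV (sitePlaqs x) (sitePlaqs y) (sitePlaqs z) (card_sitePlaqs_le x)
    (card_sitePlaqs_le y) (card_sitePlaqs_le z)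
  simp only [sum_sitePlaqs] at h
  obtain ⟨i1, i2, i3, b1, b2, b3, -⟩ := h
  have n1 : ∀ w : LinearMap.range (plaqCoboundary S), 0 ≤ sqSite x w := sqSite_nonneg x
  refine ⟨i1, i2, i3, ?_, ?_, ?_⟩
  · rw [abs_of_nonneg (integral_nonneg n1)]
    exact b1.trans (le_max_right _ _)
  · rw [abs_of_nonneg (integral_nonneg fun w => mul_nonneg (n1 w) (sqSite_nonneg y w))]
    exact b2.trans (le_max_left _ _)
  · rw [abs_of_nonneg (integral_nonneg fun w => mul_nonneg (mul_nonneg (n1 w) (sqSite_nonneg y w))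
      (sqSite_nonneg z w))]
    exact b3.trans (le_max_left _ _)

/-! ### Step D: the Gaussian cumulants of `sqSite` are the Maxwell ring and the squared kernel -/

/-- `E_γ sqSite x = Σ_q ‖frameV (x,q)‖²`. [folklore] -/
theorem integral_sqSite_gauss (x : Site 4 S) :
    ∫ w, sqSite x w ∂(stdGaussian (LinearMap.range (plaqCoboundary S))) = ∑ q, ‖frameV S (x, q)‖ ^ 2 := by
  unfold sqSite
  rw [integral_finsetSum _ fun q _ => ?_]
  · exact Finset.sum_congr rfl fun q _ => integral_inner_sq_stdGaussian _
  · exact (integrable_prod_inner_stdGaussian 2 (fun _ => frameV S (x, q))).congr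
      (ae_of_all _ fun w => by simp [pow_two])

/-- **Gaussian third cumulant of the squares = 8 × Maxwell ring.** [folklore] -/
theorem cm3_sqSite_gauss (x y z : Site 4 S) :
    cm3 (stdGaussian (LinearMap.range (plaqCoboundary S))) (sqSite x) (sqSite y) (sqSite z) =
      8 * ∑ α, ∑ α', ∑ α'', maxwellK S (x - y) α α' * maxwellK S (y - z) α' α'' * maxwellK S (z - x) α'' α := by
  have h := (stub_wickSquaresSums (fun q => frameV S (x, q)) (fun q => frameV S (y, q))
    (fun q => frameV S (z, q))).2.2.2
  unfold cm3
  simp only [integral_sqSite_gauss]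
  have e : ∀ (x : Site 4 S) (w : LinearMap.range (plaqCoboundary S)),
      sqSite x w - ∑ q, ‖frameV S (x, q)‖ ^ 2 = ∑ q, (⟪frameV S (x, q), w⟫_ℝ ^ 2 - ‖frameV S (x, q)‖ ^ 2) :=
    fun x w => by rw [sqSite, Finset.sum_sub_distrib]
  simp_rw [e, h, inner_frameV_frameV]

/-- **Gaussian covariance of the squares = 2 × squared Maxwell kernel.** [folklore] -/
theorem cm2_sqSite_gauss (x y : Site 4 S) :
    cm2 (stdGaussian (LinearMap.range (plaqCoboundary S))) (sqSite x) (sqSite y) =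
      2 * ∑ α, ∑ α', maxwellK S (x - y) α α' ^ 2 := by
  have h := (stub_wickSquaresSums (fun q => frameV S (x, q)) (fun q => frameV S (y, q))
    (fun q => frameV S (y, q))).2.2.1
  unfold cm2
  simp only [integral_sqSite_gauss]
  have e : ∀ (x : Site 4 S) (w : LinearMap.range (plaqCoboundary S)),
      sqSite x w - ∑ q, ‖frameV S (x, q)‖ ^ 2 = ∑ q, (⟪frameV S (x, q), w⟫_ℝ ^ 2 - ‖frameV S (x, q)‖ ^ 2) :=
    fun x w => by rw [sqSite, Finset.sum_sub_distrib]
  simp_rw [e, h, inner_frameV_frameV]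


/-! ### The per-site cumulants on the box -/

/-- **Per-site cumulants on the small box.**  There is a universal `C` such that for all `S`, `β > 0`,
`0 < ε ≤ 1` with `ε√β ≥ 1`, `β·#P·ε⁴ ≤ 1`, `#P·(ε√β)⁻⁶ ≤ 1` and Gaussian tail `≤ ½`, and all sites `x y z`:
`|κ₃^{box}(cosSite x, cosSite y, cosSite z) + β⁻³ ring(x,y,z)| ≤ 10 ε⁸ + C β⁻³ ξ` and
`|Cov^{box}(cosSite x, cosSite y) − β⁻²/2 Σ πK²| ≤ 10 ε⁶ + C β⁻² ξ`, `ξ = β·#P·ε⁴ + #P·(ε√β)⁻⁶`. [folklore] -/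
theorem box_cumulants : ∃ C : ℝ, 0 < C ∧ ∀ (S : ℕ) [NeZero S] (β ε : ℝ), 0 < β → 0 < ε → ε ≤ 1 →
    1 ≤ ε * Real.sqrt β → β * Fintype.card (Plaquette 4 S) * ε ^ 4 ≤ 1 →
    Fintype.card (Plaquette 4 S) * (ε * Real.sqrt β)⁻¹ ^ 6 ≤ 1 →
    (stdGaussian (LinearMap.range (plaqCoboundary S))).real
        {w | ∃ p, ε * Real.sqrt β ≤ |⟪frameV S p, w⟫_ℝ|} ≤ 1 / 2 →
    ∀ (x y z : Site 4 S),
    |cm3 (boxProb S β ε) (cosSite x) (cosSite y) (cosSite z) +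
        β⁻¹ ^ 3 * ∑ α, ∑ α', ∑ α'', maxwellK S (x - y) α α' * maxwellK S (y - z) α' α'' * maxwellK S (z - x) α'' α| ≤
      10 * ε ^ 8 + C * β⁻¹ ^ 3 *
        (β * Fintype.card (Plaquette 4 S) * ε ^ 4 + Fintype.card (Plaquette 4 S) * (ε * Real.sqrt β)⁻¹ ^ 6) ∧
    |cm2 (boxProb S β ε) (cosSite x) (cosSite y) - β⁻¹ ^ 2 / 2 * ∑ α, ∑ α', maxwellK S (x - y) α α' ^ 2| ≤
      10 * ε ^ 6 + C * β⁻¹ ^ 2 *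
        (β * Fintype.card (Plaquette 4 S) * ε ^ 4 + Fintype.card (Plaquette 4 S) * (ε * Real.sqrt β)⁻¹ ^ 6) := by
  obtain ⟨C, hC0, hR⟩ := box_raw_vs_gaussian
  obtain ⟨C₂, hC₂6, hG⟩ := integrable_sqSite_gauss
  have hC₂0 : 0 ≤ C₂ := by linarith
  set K₃ := C + 6 * C * (C₂ + 2 * C) + 6 * C * (C₂ + 2 * C) ^ 2 with hK₃
  set K₂ := C + 2 * C * (C₂ + 2 * C) with hK₂
  have hK₃0 : 0 ≤ K₃ := by positivity
  have hK₂0 : 0 ≤ K₂ := by positivity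
  refine ⟨K₃ + K₂ + 1, by positivity, fun S _ β ε hβ hε hε1 ht hw hτ htail x y z => ?_⟩
  haveI := isProbabilityMeasure_boxProb (S := S) hβ.le hε
  set bp := boxProb S β ε
  set γ := stdGaussian (LinearMap.range (plaqCoboundary S))
  set ξ := β * Fintype.card (Plaquette 4 S) * ε ^ 4 + Fintype.card (Plaquette 4 S) * (ε * Real.sqrt β)⁻¹ ^ 6 with hξ
  have hξ0 : 0 ≤ ξ := by positivity
  have hξ2 : ξ ≤ 2 := by linarith
  have hb : 0 ≤ β⁻¹ := inv_nonneg.2 hβ.le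
  -- raw moments: box vs Gaussian (degrees 1,2,3 in the needed index combinations)
  have R := fun A B D hA hB hD => hR S β ε hβ hε ht hw htail A B D hA hB hD
  have r := fun x y z => R (sitePlaqs x) (sitePlaqs y) (sitePlaqs z) (card_sitePlaqs_le x) (card_sitePlaqs_le y)
    (card_sitePlaqs_le z)
  have rxyz := r x y z
  have ryzx := r y z x
  have rzxy := r z x y
  have rxzy := r x z y
  simp only [sum_sitePlaqs] at rxyz ryzx rzxy rxzy
  -- integrability on both sides
  obtain ⟨ibx, ibxy, ibxyz⟩ := integrable_sqSite_box (S := S) hβ.le hε x y z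
  obtain ⟨iby, ibyz, -⟩ := integrable_sqSite_box (S := S) hβ.le hε y z x
  obtain ⟨ibz, -, -⟩ := integrable_sqSite_box (S := S) hβ.le hε z x y
  obtain ⟨-, ibxz, -⟩ := integrable_sqSite_box (S := S) hβ.le hε x z y
  obtain ⟨igx, igxy, igxyz, kx, kxy, kxyz⟩ := hG S x y z
  obtain ⟨igy, igyz, -, ky, kyz, -⟩ := hG S y z x
  obtain ⟨igz, -, -, kz, -, -⟩ := hG S z x y
  obtain ⟨-, igxz, -, -, kxz, -⟩ := hG S x z y
  -- central moments as polynomials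
  have Pb3 := cm3_eq_poly ibx iby ibz ibxy ibxz ibyz ibxyz
  have Pg3 := cm3_eq_poly igx igy igz igxy igxz igyz igxyz
  have Pb2 := cm2_eq_poly ibx iby ibxy
  have Pg2 := cm2_eq_poly igx igy igxy
  -- Gaussian cumulants are the ring / the squared kernel
  have G3 := cm3_sqSite_gauss (S := S) x y z
  have G2 := cm2_sqSite_gauss (S := S) x y
  -- Taylor step
  obtain ⟨T3, T2⟩ := box_taylor (S := S) hβ.le hε hε1 x y z
  -- transfer
  have mxz : ∫ w, sqSite z w * sqSite x w ∂γ = ∫ w, sqSite x w * sqSite z w ∂γ :=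
    integral_congr_ae (ae_of_all _ fun w => mul_comm _ _)
  have bxz : ∫ v, sqSite z v * sqSite x v ∂bp = ∫ v, sqSite x v * sqSite z v ∂bp :=
    integral_congr_ae (ae_of_all _ fun v => mul_comm _ _)
  constructor
  · have tr := cubic_transfer (b := β⁻¹) (ξ := ξ) hb hξ0 hξ2 hC0.le hC₂0
      (m1x := ∫ v, sqSite x v ∂bp) (m1y := ∫ v, sqSite y v ∂bp) (m1z := ∫ v, sqSite z v ∂bp)
      (m2yz := ∫ v, sqSite y v * sqSite z v ∂bp) (m2xz := ∫ v, sqSite x v * sqSite z v ∂bp)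
      (m2xy := ∫ v, sqSite x v * sqSite y v ∂bp) (m3 := ∫ v, sqSite x v * sqSite y v * sqSite z v ∂bp)
      (g1x := ∫ w, sqSite x w ∂γ) (g1y := ∫ w, sqSite y w ∂γ) (g1z := ∫ w, sqSite z w ∂γ)
      (g2yz := ∫ w, sqSite y w * sqSite z w ∂γ) (g2xz := ∫ w, sqSite x w * sqSite z w ∂γ)
      (g2xy := ∫ w, sqSite x w * sqSite y w ∂γ) (g3 := ∫ w, sqSite x w * sqSite y w * sqSite z w ∂γ)
      (by simpa only [sqSite] using rxyz.1) (by simpa only [sqSite] using ryzx.1)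
      (by simpa only [sqSite] using rzxy.1) (by simpa only [sqSite] using ryzx.2.1)
      (by simpa only [sqSite] using rxzy.2.1) (by simpa only [sqSite] using rxyz.2.1)
      (by simpa only [sqSite] using rxyz.2.2) kx ky kz kyz kxz kxy
    rw [← Pb3, ← Pg3, G3] at tr
    -- combine with the Taylor step
    have e : cm3 bp (cosSite x) (cosSite y) (cosSite z) +
        β⁻¹ ^ 3 * ∑ α, ∑ α', ∑ α'', maxwellK S (x - y) α α' * maxwellK S (y - z) α' α'' * maxwellK S (z - x) α'' α =
        (cm3 bp (cosSite x) (cosSite y) (cosSite z) + (1 / 8 : ℝ) * cm3 bp (sqSite x) (sqSite y) (sqSite z)) -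
          (1 / 8 : ℝ) * (cm3 bp (sqSite x) (sqSite y) (sqSite z) - β⁻¹ ^ 3 *
            (8 * ∑ α, ∑ α', ∑ α'', maxwellK S (x - y) α α' * maxwellK S (y - z) α' α'' *
              maxwellK S (z - x) α'' α)) := by ring
    rw [e]
    refine (abs_sub _ _).trans ?_
    rw [abs_mul, abs_of_pos (by norm_num : (0 : ℝ) < 1 / 8)]
    have hKle : K₃ * β⁻¹ ^ 3 * ξ ≤ (K₃ + K₂ + 1) * β⁻¹ ^ 3 * ξ := by gcongr; linarith
    linarith [tr, T3, hKle, mul_nonneg (mul_nonneg hK₃0 (pow_nonneg hb 3)) hξ0, abs_nonneg (cm3 bp (sqSite x) (sqSite y) (sqSite z) - β⁻¹ ^ 3 *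
            (8 * ∑ α, ∑ α', ∑ α'', maxwellK S (x - y) α α' * maxwellK S (y - z) α' α'' *
              maxwellK S (z - x) α'' α))]
  · have tr := quadratic_transfer (b := β⁻¹) (ξ := ξ) hb hξ0 hξ2 hC0.le hC₂0
      (m1x := ∫ v, sqSite x v ∂bp) (m1y := ∫ v, sqSite y v ∂bp) (m2xy := ∫ v, sqSite x v * sqSite y v ∂bp)
      (g1x := ∫ w, sqSite x w ∂γ) (g1y := ∫ w, sqSite y w ∂γ) (g2xy := ∫ w, sqSite x w * sqSite y w ∂γ)
      (by simpa only [sqSite] using rxyz.1) (by simpa only [sqSite] using ryzx.1)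
      (by simpa only [sqSite] using rxyz.2.1) kx ky
    rw [← Pb2, ← Pg2, G2] at tr
    have e : cm2 bp (cosSite x) (cosSite y) - β⁻¹ ^ 2 / 2 * ∑ α, ∑ α', maxwellK S (x - y) α α' ^ 2 =
        (cm2 bp (cosSite x) (cosSite y) - (1 / 4 : ℝ) * cm2 bp (sqSite x) (sqSite y)) +
          (1 / 4 : ℝ) * (cm2 bp (sqSite x) (sqSite y) - β⁻¹ ^ 2 * (2 * ∑ α, ∑ α', maxwellK S (x - y) α α' ^ 2)) := by
      ring
    rw [e]
    refine (abs_add_le _ _).trans ?_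
    rw [abs_mul, abs_of_pos (by norm_num : (0 : ℝ) < 1 / 4)]
    have hKle : K₂ * β⁻¹ ^ 2 * ξ ≤ (K₃ + K₂ + 1) * β⁻¹ ^ 2 * ξ := by gcongr; linarith
    linarith [tr, T2, hKle, mul_nonneg (mul_nonneg hK₂0 (pow_nonneg hb 2)) hξ0]

end Summit.QuantumFields.YangMills.Theorems.SelfNormalisedSkewness.Negative

end
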